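import Summits.BirchSwinnertonDyer.Rank1Residual.Additive.X3BranchLayerCyclotomicTower
import Literature.NumberTheory.EllipticCurves.CyclotomicZpExtensionLayerProofs
import Literature.NumberTheory.GaloisRepresentations.ImaginaryQuadraticCyclotomicProofs
import Mathlib.NumberTheory.RamificationInertia.Valuation
import HarnessLib

/-!
# X3, the DEGENERATE rows, class-level count: the layers `ℚ_N ⊆ ℚ(ζ_{p^{N+1}})` and the VALUATION of
# `p` at the primes of `ℚ_N` above `p` — `v_w(p) = exp(−p^N)`, in particular `e(w|3) = 3^N` is ODD
# (cell `bsd-eis`, seat `bsd-eis-x3` gen 9; brick G3b of x3-MEMO-11, the input `hodd` of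
# `KummerFamily.natCard_units_quot_cubes_le`; route K1 `AdditiveBranchIMC`, crux
# `GordTwoRankZeroOffCaseOne` — supports only)

HONEST FRAMING (`run/shared/lean/pub/bsd-eis/README.md` §4): THEOREMS ONLY (no `def`, no named fact,
no `sorry`); nothing is booked; no label, tier or count of record moves.

## What
* §1 `KummerFamily.liesOver_span_of_natCast_mem` — a prime `w` of `𝓞_K` containing the rational prime
  `p` lies over `(p) ⊆ ℤ`; `KummerFamily.valuation_natCast_eq_exp_neg_ramificationIdx'` —
  `v_w(p) = exp(−e(w|p))` (Mathlib `intValuation_liesOver` over the place `(p)` of `ℤ`).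
* §2 `ZpExtension.IsCyclotomic.layer_le_adjoin` — for a cyclotomic `κ` (`p` odd) and a primitive
  `p^{N+1}`-th root of unity `ζ ∈ ℚ̄`: `ℚ_N ≤ ℚ(ζ)` (tree `rootsOfUnityFixer_le_layerSubgroup` + the
  infinite Galois correspondence).
* §3 `ZpExtension.IsCyclotomic.valuation_natCast_layer` — every prime `w ∣ p` of `ℚ_N` has
  `v_w(p) = exp(−p^N)` (G3a: `e(w|p) = [ℚ_N : ℚ] = p^N`), so `e(w|p)` is odd when `p` is odd
  (`odd_ramification_layer`, the hypothesis `hodd` of the mod-`9` count).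
References: [Washington1997] §13.1, Lemma 1.4, Prop. 2.3; [NeukirchANT1999] Ch. I (8.2), Ch. II (3.8).
-/

set_option autoImplicit false

noncomputable section

open scoped Classical NumberField

namespace Summit.BirchSwinnertonDyer.Rank1Residual.Additive

namespace KummerFamily

open NumberField IsDedekindDomain WithZero

variable (K : Type) [Field K] [NumberField K] (p : ℕ) [hp : Fact p.Prime]

omit [NumberField K] in
/-- A prime of `𝓞_K` containing the rational prime `p` lies over `(p) ⊆ ℤ` (the contraction is a
prime ideal of `ℤ` containing the maximal ideal `(p)`). [folklore] -/
theorem liesOver_span_of_natCast_mem (w : HeightOneSpectrum (𝓞 K)) (hw : (p : 𝓞 K) ∈ w.asIdeal) :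
    w.asIdeal.LiesOver (Ideal.span {(p : ℤ)}) := by
  have hpmax : (Ideal.span {(p : ℤ)}).IsMaximal :=
    Ideal.IsPrime.isMaximal
      ((Ideal.span_singleton_prime (by exact_mod_cast hp.out.ne_zero)).mpr
        (Nat.prime_iff_prime_int.mp hp.out))
      (by rw [Ne, Ideal.span_singleton_eq_bot]; exact_mod_cast hp.out.ne_zero)
  refine ⟨(hpmax.eq_of_le ?_ ?_)⟩
  · exact Ideal.IsPrime.ne_top (Ideal.IsPrime.under ℤ w.asIdeal)
  · rw [Ideal.span_le, Set.singleton_subset_iff]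
    change algebraMap ℤ (𝓞 K) (p : ℤ) ∈ w.asIdeal
    rwa [map_natCast]

/-- **`v_w(p) = exp(−e(w|p))`** for a prime `w` of `𝓞_K` over `(p)`. [cite: NeukirchANT1999, Ch. II (3.8)] -/
theorem valuation_natCast_eq_exp_neg_ramificationIdx' (w : HeightOneSpectrum (𝓞 K))
    [hw : w.asIdeal.LiesOver (Ideal.span {(p : ℤ)})] :
    w.valuation K (p : K) = exp (-((Ideal.span {(p : ℤ)}).ramificationIdx' w.asIdeal : ℤ)) := by
  have hpbot : Ideal.span {(p : ℤ)} ≠ ⊥ := by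
    rw [Ne, Ideal.span_singleton_eq_bot]; exact_mod_cast hp.out.ne_zero
  let v : HeightOneSpectrum ℤ :=
    ⟨Ideal.span {(p : ℤ)}, (Ideal.span_singleton_prime (by exact_mod_cast hp.out.ne_zero)).mpr
      (Nat.prime_iff_prime_int.mp hp.out), hpbot⟩
  haveI : w.asIdeal.LiesOver v.asIdeal := hw
  have h := IsDedekindDomain.HeightOneSpectrum.intValuation_liesOver v w (p : ℤ)
  have hv : v.intValuation (p : ℤ) = exp (-1 : ℤ) :=
    v.intValuation_singleton (by exact_mod_cast hp.out.ne_zero) rfl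
  rw [hv, ← exp_nsmul, map_natCast] at h
  rw [show (p : K) = algebraMap (𝓞 K) K (p : 𝓞 K) by simp,
    IsDedekindDomain.HeightOneSpectrum.valuation_of_algebraMap, ← h]
  congr 1
  rw [smul_neg, nsmul_eq_mul, mul_one]

end KummerFamily

end Summit.BirchSwinnertonDyer.Rank1Residual.Additive

namespace Literature.NumberTheory.EllipticCurves.ZpExtension

open Field NumberField IsDedekindDomain WithZero Literature.NumberTheory.GaloisRepresentations
  Summit.BirchSwinnertonDyer.Rank1Residual.Additive

variable {p : ℕ} [hp : Fact p.Prime] {κ : ZpExtension ℚ p}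

/-- **`ℚ_N ≤ ℚ(ζ_{p^{N+1}})` inside `ℚ̄`** for a cyclotomic `κ` and `p` odd: an automorphism fixing `ℚ(ζ)`
fixes every `p^{N+1}`-th root of unity, hence lies in `κ⁻¹(p^N ℤ_p)` (tree
`rootsOfUnityFixer_le_layerSubgroup`), whose fixed field is `ℚ_N`; conclude by the infinite Galois
correspondence. [cite: Washington1997, §13.1] -/
theorem IsCyclotomic.layer_le_adjoin (hκ : κ.IsCyclotomic) (hp2 : p ≠ 2) (N : ℕ)
    {ζ : AlgebraicClosure ℚ} (hζ : IsPrimitiveRoot ζ (p ^ (N + 1))) :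
    κ.layer N ≤ @IntermediateField.adjoin ℚ _ (AlgebraicClosure ℚ) _ (AlgebraicClosure.instAlgebra ℚ) {ζ} := by
  haveI : @IsGalois ℚ _ (AlgebraicClosure ℚ) _ (AlgebraicClosure.instAlgebra ℚ) :=
    @IsAlgClosure.isGalois ℚ (AlgebraicClosure ℚ) _ _ (AlgebraicClosure.instAlgebra ℚ) inferInstance
      inferInstance
  set L := @IntermediateField.adjoin ℚ _ (AlgebraicClosure ℚ) _ (AlgebraicClosure.instAlgebra ℚ) {ζ}
    with hL
  have hζL : ζ ∈ L := IntermediateField.mem_adjoin_simple_self ℚ ζ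
  have hfix : L.fixingSubgroup ≤ (κ.layerSubgroup N).map (absoluteGaloisGroup.toAlgEquiv ℚ).toMonoidHom := by
    intro f hf
    rw [IntermediateField.mem_fixingSubgroup_iff] at hf
    have hζf : f ζ = ζ := hf ζ hζL
    refine ⟨(absoluteGaloisGroup.toAlgEquiv ℚ).symm f, ?_, by simp⟩
    refine hκ.rootsOfUnityFixer_le_layerSubgroup hp2 N ?_
    intro t ht
    haveI : NeZero (p ^ (N + 1)) := ⟨pow_ne_zero _ hp.out.ne_zero⟩
    obtain ⟨j, -, rfl⟩ := hζ.eq_pow_of_pow_eq_one ht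
    rw [absoluteGaloisGroup.toAlgEquiv_symm_apply, map_pow]
    exact congrArg (· ^ j) hζf
  calc κ.layer N
      = IntermediateField.fixedField
          ((κ.layerSubgroup N).map (absoluteGaloisGroup.toAlgEquiv ℚ).toMonoidHom) := rfl
    _ ≤ IntermediateField.fixedField L.fixingSubgroup := IntermediateField.fixedField_antitone hfix
    _ = L := InfiniteGalois.fixedField_fixingSubgroup L

/-- **`v_w(p) = exp(−p^N)` at every prime `w ∣ p` of the layer `ℚ_N`** of a cyclotomic `ℤ_p`-extension
of `ℚ`, `p` odd: `ℚ_N ⊆ ℚ(ζ_{p^{N+1}})` is totally ramified at `p` with `e(w|p) = [ℚ_N : ℚ] = p^N`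
(G3a `KummerFamily.ramificationIdx'_eq_finrank_of_algebra_cyclotomic`, `finrank_layer_holds`).
[cite: Washington1997, §13.1 and Prop. 2.3] -/
theorem IsCyclotomic.valuation_natCast_layer (hκ : κ.IsCyclotomic) (hp2 : p ≠ 2) (N : ℕ)
    (w : HeightOneSpectrum (𝓞 (κ.layer N))) (hw : (p : 𝓞 (κ.layer N)) ∈ w.asIdeal) :
    haveI : FiniteDimensional ℚ (κ.layer N) := κ.finiteDimensional_layer_holds N
    haveI : NumberField (κ.layer N) := NumberField.of_module_finite ℚ (κ.layer N)
    w.valuation (κ.layer N) (p : κ.layer N) = exp (-((p ^ N : ℕ) : ℤ)) := by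
  haveI : FiniteDimensional ℚ (κ.layer N) := κ.finiteDimensional_layer_holds N
  haveI : NumberField (κ.layer N) := NumberField.of_module_finite ℚ (κ.layer N)
  haveI : NeZero (p ^ (N + 1)) := ⟨pow_ne_zero _ hp.out.ne_zero⟩
  obtain ⟨ζ, hζ⟩ := HasEnoughRootsOfUnity.exists_primitiveRoot (AlgebraicClosure ℚ) (p ^ (N + 1))
  set L := @IntermediateField.adjoin ℚ _ (AlgebraicClosure ℚ) _ (AlgebraicClosure.instAlgebra ℚ) {ζ}
    with hL
  haveI : @Algebra.IsIntegral ℚ (AlgebraicClosure ℚ) _ _ (AlgebraicClosure.instAlgebra ℚ) :=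
    Algebra.isAlgebraic_iff_isIntegral.mp (AlgebraicClosure.isAlgebraic ℚ)
  haveI : IsCyclotomicExtension {p ^ (N + 1)} ℚ L :=
    IsPrimitiveRoot.intermediateField_adjoin_isCyclotomicExtension (K := ℚ) hζ
  haveI : FiniteDimensional ℚ L :=
    IntermediateField.adjoin.finiteDimensional (Algebra.IsIntegral.isIntegral ζ)
  haveI : NumberField L := NumberField.of_module_finite ℚ L
  have hle : κ.layer N ≤ L := hκ.layer_le_adjoin hp2 N hζ
  letI : Algebra (κ.layer N) L := (IntermediateField.inclusion hle).toRingHom.toAlgebra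
  haveI := KummerFamily.liesOver_span_of_natCast_mem (κ.layer N) p w hw
  rw [KummerFamily.valuation_natCast_eq_exp_neg_ramificationIdx' (κ.layer N) p w,
    KummerFamily.ramificationIdx'_eq_finrank_of_algebra_cyclotomic p N (κ.layer N) w (L := L),
    κ.finrank_layer_holds N]

/-- **Every prime of `ℚ_N` above `p` has ODD absolute ramification index** (`= p^N`, `p` odd), in the
valuation form consumed by `KummerFamily.natCard_units_quot_cubes_le`. [cite: Washington1997, §13.1] -/
theorem IsCyclotomic.odd_ramification_layer (hκ : κ.IsCyclotomic) (hp2 : p ≠ 2) (N : ℕ)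
    (w : HeightOneSpectrum (𝓞 (κ.layer N))) (hw : (p : 𝓞 (κ.layer N)) ∈ w.asIdeal) :
    haveI : FiniteDimensional ℚ (κ.layer N) := κ.finiteDimensional_layer_holds N
    haveI : NumberField (κ.layer N) := NumberField.of_module_finite ℚ (κ.layer N)
    ∃ e : ℕ, Odd e ∧ w.valuation (κ.layer N) (p : κ.layer N) = exp (-(e : ℤ)) := by
  refine ⟨p ^ N, ?_, hκ.valuation_natCast_layer hp2 N w hw⟩
  exact Odd.pow (hp.out.odd_of_ne_two hp2)

end Literature.NumberTheory.EllipticCurves.ZpExtension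

end
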